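import Summits.ABC.IUTFork.Thm311RealIsmDHMoverCriterion
import HarnessLib

/-!
# [IUTchIII] Cor. 3.12, (Ind2) at one factor: Dupuy–Hilado's `Real.ismDH` is TRANSITIVE on primitive vectors of the
# log-shell, and the (Ind2)-orbit of any compact region additively generates exactly a `p^k·log_p(𝒪_v^×)`

PROOF-ONLY file (abc-iut cell, WAVE-5 seat abc-iut-w5-d180, gen 4); TAKES NO SIDE on [IUTchIII] Cor. 3.12.  The
one-factor «hull LOWER bound via explicit lattice movers» asked for on HOME/STATUS (abc-iut-w4-d094 08:41:43Z (iii);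
abc-iut-c312-3 08:51:10Z MATH NOTE steps (i)–(iii)), read through the dictionary of `Thm311RealIsmDHMoverCriterion`
(`Real.ismDH logv (inr v)` ↔ `Aut_{ℚ_p}(K_v : log_p(𝒪_v^×))`) from this seat's lineage file `LatticeAutOrbits`
(Weil *BNT* II §2: lattice automorphisms act transitively on primitive vectors; the orbit of a content-`c` region
generates `c·Λ`) and `LatticeAutStableSubgroups` (every compact subgroup has a content):

* `exists_mem_ismDH_apply_eq_of_primitive` — for `x, y ∈ c·log_p(𝒪_v^×)` both OUTSIDE `p·c·log_p(𝒪_v^×)` (primitive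
  vectors of the lattice `c·log_p(𝒪_v^×)`, e.g. of the log-shell `I_v`, `c = (p^*)⁻¹`) there is `g ∈ Real.ismDH logv (inr v)`
  with `g x = y`;
* `exists_closure_iUnion_ismDH_image_eq` — for every compact additive subgroup `M ≠ 0` of `K_v` (e.g. a ball `t·𝒪_v`,
  `exists_closure_iUnion_ismDH_image_closedBall_eq`) there is `k ∈ ℤ` with `M ⊆ p^k·log_p(𝒪_v^×)` and
  `closure (⋃_{g ∈ (Ind2)} g(M)) = p^k·log_p(𝒪_v^×)` EXACTLY: the additive span of the (Ind2)-orbit of a region depends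
  on the region only through its content in the lattice `log_p(𝒪_v^×)`.

[cite: DupuyHilado2025, §4.9] [cite: WeilBNT1967, Ch. II §2, Th. 1–2] [cite: Cassels1997, Ch. I §2, Th. I Cor. 3]
[claim: Mochizuki2012, status: disputed] for every [IUTchIII] locution.  Nothing here computes a hull of the
(j+1)-fold tensor packet (that transport is abc-iut-c312-5's); nothing asserts or refutes Cor. 3.12.
-/

noncomputable section

open Set Metric NumberField IsDedekindDomain
open scoped Pointwise

namespace Summit.ABC.IUTFork.Thm311.Real

open Cor312Vol Literature.IUT.LogThetaLattice Literature.IUT.LogVolume Literature.NumberTheory.NumberFields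
open Literature.NumberTheory.GaloisRepresentations.Ultrametric

variable {F : Type} [Field F] [NumberField F] {p : ℕ} [hp : Fact p.Prime]
variable {logv : PadicLogs F} (hlog : LogvAnalyticAt p logv)
variable (v : HeightOneSpectrum (𝓞 F)) (hv : ((p : ℕ) : 𝓞 F) ∈ v.asIdeal)

include hlog

/-! ## 1. The (Ind2)-orbit and the lattice-automorphism orbit are the same family of sets -/

/-- The family of (Ind2)-images of a region IS the family of its images under the lattice automorphisms of
`log_p(𝒪_v^×)` (dictionary of `Thm311RealIsmDHMoverCriterion`). [cite: DupuyHilado2025, §4.9] -/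
theorem iUnion_ismDH_image_eq_iUnion_latticeAut_image {n : ℕ}
    (B : Module.Basis (Fin n) ℚ_[p] (RescaledCompletion F p v hv))
    (hΛ : (logUnits (RescaledCompletion F p v hv) : Set (RescaledCompletion F p v hv)) =
      (PadicModule.basisLattice p B : Set (RescaledCompletion F p v hv)))
    (M : Set (RescaledCompletion F p v hv)) :
    (⋃ g ∈ ismDH logv (.inr v), (fun a => toR p v hv (g (ofR p v hv a))) '' M) =
      ⋃ φ ∈ latticeAut ℚ_[p] (PadicModule.basisLattice p B).toIntSubmodule,
        (φ : RescaledCompletion F p v hv ≃ₗ[ℚ_[p]] RescaledCompletion F p v hv) '' M := by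
  ext z
  simp only [Set.mem_iUnion]
  constructor
  · rintro ⟨g, hg, hz⟩
    obtain ⟨φ, hφ, hφg⟩ := exists_mem_latticeAut_of_mem_ismDH hlog B hΛ hg
    refine ⟨φ, hφ, ?_⟩
    have hfun : (fun a => toR p v hv (g (ofR p v hv a))) = φ := (funext hφg).symm
    rwa [hfun] at hz
  · rintro ⟨φ, hφ, hz⟩
    obtain ⟨g, hg, hgφ⟩ := exists_mem_ismDH_of_mem_latticeAut hlog B hΛ hφ
    refine ⟨g, hg, ?_⟩
    have hfun : (fun a => toR p v hv (g (ofR p v hv a))) = φ := funext hgφ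
    rwa [hfun]

/-! ## 2. Transitivity on primitive vectors -/

/-- **DH's (Ind2) is transitive on the primitive vectors of `c·log_p(𝒪_v^×)`** (`c ≠ 0`; e.g. `c = (p^*)⁻¹`: the
log-shell `I_v`): for `x, y ∈ c·log_p(𝒪_v^×)` both outside `p·c·log_p(𝒪_v^×)` some `g ∈ Real.ismDH logv (inr v)` maps
`x` to `y` (Weil II §2 Th. 1 «a primitive point may be taken as part of a basis», tree `exists_latticeAut_map_eq`).
[cite: WeilBNT1967, Ch. II §2, Th. 1] [cite: Cassels1997, Ch. I §2, Th. I Cor. 3] [cite: DupuyHilado2025, §4.9] -/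
theorem exists_mem_ismDH_apply_eq_of_primitive {c : ℚ_[p]} {x y : RescaledCompletion F p v hv}
    (hx : x ∈ c • (logUnits (RescaledCompletion F p v hv) : Set (RescaledCompletion F p v hv)))
    (hxp : x ∉ ((p : ℚ_[p]) * c) • (logUnits (RescaledCompletion F p v hv) : Set (RescaledCompletion F p v hv)))
    (hy : y ∈ c • (logUnits (RescaledCompletion F p v hv) : Set (RescaledCompletion F p v hv)))
    (hyp : y ∉ ((p : ℚ_[p]) * c) • (logUnits (RescaledCompletion F p v hv) : Set (RescaledCompletion F p v hv))) :
    ∃ g ∈ ismDH logv (.inr v), toR p v hv (g (ofR p v hv x)) = y := by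
  set K := RescaledCompletion F p v hv
  obtain ⟨n, hn, B, hΛ⟩ := exists_basis_coe_logUnits_eq (p := p) v hv
  rw [hΛ] at hx hy hxp hyp
  -- descale: `x = c • x₁`, `y = c • y₁` with `x₁, y₁ ∈ Λ ∖ p·Λ` primitive
  obtain ⟨x₁, hx₁, rfl⟩ := hx
  obtain ⟨y₁, hy₁, rfl⟩ := hy
  have hprim : ∀ {w : K}, w ∈ (PadicModule.basisLattice p B : Set K) →
      c • w ∉ ((p : ℚ_[p]) * c) • (PadicModule.basisLattice p B : Set K) → ∃ i, ‖B.repr w i‖ = 1 := by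
    intro w hw hwp
    refine (PadicModule.primitive_iff_not_mem_p_smul p B hw).2 fun hmem => hwp ?_
    obtain ⟨u, hu, hwu⟩ := hmem
    refine ⟨u, hu, ?_⟩
    show ((p : ℚ_[p]) * c) • u = c • w
    rw [mul_comm, mul_smul, show (p : ℚ_[p]) • u = w from hwu]
  obtain ⟨i, hi⟩ := hprim hx₁ hxp
  obtain ⟨j, hj⟩ := hprim hy₁ hyp
  obtain ⟨φ, hφ, hφxy⟩ := PadicModule.exists_latticeAut_map_eq p B hx₁ hy₁ hi hj
  obtain ⟨g, hg, hgφ⟩ := exists_mem_ismDH_of_mem_latticeAut hlog B hΛ hφ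
  refine ⟨g, hg, ?_⟩
  rw [hgφ, LinearEquiv.map_smul, hφxy]

/-! ## 3. The additive span of the (Ind2)-orbit of a compact region -/

/-- **The (Ind2)-orbit of a compact subgroup `M ≠ 0` additively generates EXACTLY `p^k·log_p(𝒪_v^×)`** for the
content `k` of `M` (`M ⊆ p^k·log_p(𝒪_v^×)`, and `M` contains a vector of content exactly `p^k`): the one-factor
hull LOWER bound by explicit lattice movers. [cite: WeilBNT1967, Ch. II §2, Th. 1–2] [cite: DupuyHilado2025, §4.9] -/
theorem exists_closure_iUnion_ismDH_image_eq (M : AddSubgroup (RescaledCompletion F p v hv))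
    (hMc : IsCompact (M : Set (RescaledCompletion F p v hv))) (hM0 : ∃ y ∈ M, y ≠ 0) :
    ∃ k : ℤ, (M : Set (RescaledCompletion F p v hv)) ⊆
        ((p : ℚ_[p]) ^ k) • (logUnits (RescaledCompletion F p v hv) : Set (RescaledCompletion F p v hv)) ∧
      (AddSubgroup.closure (⋃ g ∈ ismDH logv (.inr v),
          (fun a => toR p v hv (g (ofR p v hv a))) '' (M : Set (RescaledCompletion F p v hv))) :
        Set (RescaledCompletion F p v hv)) =
        ((p : ℚ_[p]) ^ k) • (logUnits (RescaledCompletion F p v hv) : Set (RescaledCompletion F p v hv)) := by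
  obtain ⟨n, hn, B, hΛ⟩ := exists_basis_coe_logUnits_eq (p := p) v hv
  obtain ⟨c, x₀, i, hc0, hx₀, hi, hxM, hM⟩ := PadicModule.exists_content_of_isCompact p B M hMc hM0
  obtain ⟨k, hk⟩ := PadicModule.exists_smul_basisLattice_eq_zpow_smul p B hc0
  refine ⟨k, ?_, ?_⟩
  · rw [hΛ, ← hk]; exact hM
  · rw [iUnion_ismDH_image_eq_iUnion_latticeAut_image hlog v hv B hΛ, hΛ, ← hk]
    exact PadicModule.coe_closure_iUnion_image_eq p B hx₀ hi hxM hM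

/-- **Ball form**: the (Ind2)-orbit of `t·𝒪_v = {‖y‖ ≤ ‖t‖}` (`t ≠ 0`) additively generates exactly some
`p^k·log_p(𝒪_v^×) ⊇ t·𝒪_v`. [cite: WeilBNT1967, Ch. II §2, Th. 1–2] [cite: DupuyHilado2025, §4.9] -/
theorem exists_closure_iUnion_ismDH_image_closedBall_eq {t : RescaledCompletion F p v hv} (ht : t ≠ 0) :
    ∃ k : ℤ, closedBall (0 : RescaledCompletion F p v hv) ‖t‖ ⊆
        ((p : ℚ_[p]) ^ k) • (logUnits (RescaledCompletion F p v hv) : Set (RescaledCompletion F p v hv)) ∧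
      (AddSubgroup.closure (⋃ g ∈ ismDH logv (.inr v),
          (fun a => toR p v hv (g (ofR p v hv a))) '' closedBall (0 : RescaledCompletion F p v hv) ‖t‖) :
        Set (RescaledCompletion F p v hv)) =
        ((p : ℚ_[p]) ^ k) • (logUnits (RescaledCompletion F p v hv) : Set (RescaledCompletion F p v hv)) := by
  have hr : 0 < ‖t‖ := norm_pos_iff.2 ht
  have hM : (((IsUltrametricDist.closedBall_openAddSubgroup (RescaledCompletion F p v hv) hr :
      OpenAddSubgroup (RescaledCompletion F p v hv)) : AddSubgroup (RescaledCompletion F p v hv)) :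
        Set (RescaledCompletion F p v hv)) = closedBall 0 ‖t‖ := rfl
  have h := exists_closure_iUnion_ismDH_image_eq hlog v hv
    ((IsUltrametricDist.closedBall_openAddSubgroup (RescaledCompletion F p v hv) hr :
      OpenAddSubgroup (RescaledCompletion F p v hv)) : AddSubgroup (RescaledCompletion F p v hv))
    (hM ▸ isCompact_closedBall (0 : RescaledCompletion F p v hv) ‖t‖)
    ⟨t, by
      show t ∈ closedBall (0 : RescaledCompletion F p v hv) ‖t‖
      exact mem_closedBall_zero_iff.2 le_rfl, ht⟩
  rw [hM] at h
  exact h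

end Summit.ABC.IUTFork.Thm311.Real

end
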